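import Mathlib
import Summits.Ventures.PercRepro2.K5HyperI

/-!
# THE (i)-SIDE HYPEREDGE BASE TERMS, TYPE `2`
(blind cell PercRepro2, typer-1 g10; mine-1 §23.5 — the (i)-side; twin `k5hyper_i_typer.py`, `0` violations)

One `decide +kernel` per triangle and type: `N⁽ⁱ⁾(H + T(2)) ≥ 0` at every `K₅` profile (the hyperedge of type `2`, i.e. the triangle forced open in exactly two copies).
-/

namespace Summit.Ventures.PercRepro2

namespace K5

set_option maxRecDepth 100000 in
/-- `N⁽ⁱ⁾(H + T(2)) ≥ 0` on the triangle `T = {0, 1, 2}`. -/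
theorem cert_T2I_012 : CertLE (sumT2 posOnI (triMask 0 1 2)) (sumT2 negOnI (triMask 0 1 2)) := by
  unfold CertLE
  decide +kernel

set_option maxRecDepth 100000 in
/-- `N⁽ⁱ⁾(H + T(2)) ≥ 0` on the triangle `T = {0, 1, 3}`. -/
theorem cert_T2I_013 : CertLE (sumT2 posOnI (triMask 0 1 3)) (sumT2 negOnI (triMask 0 1 3)) := by
  unfold CertLE
  decide +kernel

set_option maxRecDepth 100000 in
/-- `N⁽ⁱ⁾(H + T(2)) ≥ 0` on the triangle `T = {0, 1, 4}`. -/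
theorem cert_T2I_014 : CertLE (sumT2 posOnI (triMask 0 1 4)) (sumT2 negOnI (triMask 0 1 4)) := by
  unfold CertLE
  decide +kernel

set_option maxRecDepth 100000 in
/-- `N⁽ⁱ⁾(H + T(2)) ≥ 0` on the triangle `T = {0, 2, 3}`. -/
theorem cert_T2I_023 : CertLE (sumT2 posOnI (triMask 0 2 3)) (sumT2 negOnI (triMask 0 2 3)) := by
  unfold CertLE
  decide +kernel

set_option maxRecDepth 100000 in
/-- `N⁽ⁱ⁾(H + T(2)) ≥ 0` on the triangle `T = {0, 2, 4}`. -/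
theorem cert_T2I_024 : CertLE (sumT2 posOnI (triMask 0 2 4)) (sumT2 negOnI (triMask 0 2 4)) := by
  unfold CertLE
  decide +kernel

set_option maxRecDepth 100000 in
/-- `N⁽ⁱ⁾(H + T(2)) ≥ 0` on the triangle `T = {0, 3, 4}`. -/
theorem cert_T2I_034 : CertLE (sumT2 posOnI (triMask 0 3 4)) (sumT2 negOnI (triMask 0 3 4)) := by
  unfold CertLE
  decide +kernel

set_option maxRecDepth 100000 in
/-- `N⁽ⁱ⁾(H + T(2)) ≥ 0` on the triangle `T = {1, 2, 3}`. -/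
theorem cert_T2I_123 : CertLE (sumT2 posOnI (triMask 1 2 3)) (sumT2 negOnI (triMask 1 2 3)) := by
  unfold CertLE
  decide +kernel

set_option maxRecDepth 100000 in
/-- `N⁽ⁱ⁾(H + T(2)) ≥ 0` on the triangle `T = {1, 2, 4}`. -/
theorem cert_T2I_124 : CertLE (sumT2 posOnI (triMask 1 2 4)) (sumT2 negOnI (triMask 1 2 4)) := by
  unfold CertLE
  decide +kernel

set_option maxRecDepth 100000 in
/-- `N⁽ⁱ⁾(H + T(2)) ≥ 0` on the triangle `T = {1, 3, 4}`. -/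
theorem cert_T2I_134 : CertLE (sumT2 posOnI (triMask 1 3 4)) (sumT2 negOnI (triMask 1 3 4)) := by
  unfold CertLE
  decide +kernel

set_option maxRecDepth 100000 in
/-- `N⁽ⁱ⁾(H + T(2)) ≥ 0` on the triangle `T = {2, 3, 4}`. -/
theorem cert_T2I_234 : CertLE (sumT2 posOnI (triMask 2 3 4)) (sumT2 negOnI (triMask 2 3 4)) := by
  unfold CertLE
  decide +kernel

end K5

end Summit.Ventures.PercRepro2
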